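/-
Copyright (c) 2026 the pub-hodgecm-mathlib formalisation cell (harness21).  Prover seat hodgecm-mathlib-A-p19 (g28): «S3-ram» seeding wave (LEAD F0P3a-plan (g13);
owner F0P3a-p06 (g15); (Cnt2′) chair F0P3a-p07 (g14)), row (z4-i) «the BLOCK FRAME of the opposite literal IN THE e-CURRENCY», paired with A-p12 (g24); 2026-09-02.
-/
import Literature.NumberTheory.Rogawski1990.TypeTwoRamifiedOppositeLiteral                  -- ★ p847834 (this seat): `length_inv_mulVec_of_frame`, `stdForm_antidiagonal_one_over_eq`, `mul_self_map_eq_one_of_oneByOne_unitary`; brings ★ p847566, ★ p846897, ★ p847309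
import Literature.NumberTheory.Rogawski1990.TypeTwoAnisotropicLiteralDiagonalFrameRamified   -- (this seat) `exists_anisotropicLiteral_frame_ram`
import HarnessLib

/-!
# The type-(2) literal of sign `−(y_λ, θ)_v` at a TAMELY RAMIFIED place WITH ITS DIAGONAL BLOCK FRAME, in the lattice currency `(e, heA)` of ★ p847724
# (Rogawski 1990 §4.9 Prop. 4.9.1, §3.5–§3.6; Jacobowitz 1962 §8; Labesse–Langlands 1979 §2)

Topic `NumberTheory/Rogawski1990`; namespace `Literature.NumberTheory.Rogawski1990`.  THEOREMS ONLY (no definition, no instance, no notation, no named fact, no `sorry`); kernel lane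
`--supports stmt-HodgeConjecture-24833`.  Cell `pub/hodgecm-mathlib` (D-0151), crux H413; road «S3-ram», fold `LocalTransferAtOneTameRamified` (fold pen F0P3-p02 (g17)); row **(z4-i)** of
the (Cnt2′) chair's roadmap (F0P3a-p07 (g14), rulings (5) 02:25:51Z «A-p19 pairs with A-p12 (g24) on (z4-i): the BLOCK FRAME of ★ t₁ in p05's e-currency» and (6) 02:39:51Z «= mod
spelling: the form clause as the printed `!![…]` ι-shape»).  CONSUMER: A-p12 (g24)'s (z4-ii) assembly head for the lattice-currency sockets `stub_T2G_{zero,pm}_{par}_lat` (★ p847724,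
(Cnt2′) skeleton v4), which reads the fixed self-dual lattices of `e t₁` through the frame `P₁` on the DIAGONAL block form, where ★ `UnitaryLatticeTreeAnisotropicAxisCount` ((z1-e′))
makes every anisotropic axis count an indicator.
HONEST LABEL: HC_CM is proved only modulo the cell's 2 remaining named inputs (hLiu418 24832, h413 24833) until rung 0 closes; unconditional local algebra, count-neutral.

THE MATHEMATICS.  ★ `exists_vDeep_oppositeLiteral_ram` (part C) produced, for a type-(2) `γ_H = (g, u)` in the 2-deep tube at a tame-ramified non-split `w`, a match `t₁ ∈ G′_v`, v-deep, with
`κ_v(γ_H, t₁) = −(y_λ, θ)_v`, as the pull-back `e⁻¹(Y)` of the anisotropic literal `Y ∈ U(σ_w, J₀)` along the wave's one-place frame.  Here the SAME construction is run with the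
diagonal block frame of ★ `exists_anisotropicLiteral_frame_ram` and stated for ANY frame `e : G′_v ≃ₜ* U(σ_w, Φ₃)(L_w)` with `e(x) = A·x_w·A⁻¹` (the binders `(e) (heA)` of ★ p847724
VERBATIM; matching ⟺ conjugacy with the pattern is ★ `isLocalNormPair_iff_isConj_endoGL_conj`; the κ-step is isolated as `finKappaAt_eq_neg_hilbertSymbol_of_nonNorm_length`):
**`exists_vDeep_oppositeLiteral_frame_ram`** — `∃ t₁ P₁ d η γ₁` with the three clauses
of part C VERBATIM and `e t₁ = P₁·ι(γ₁, u_w)·P₁⁻¹`, `P₁ ∈ GL₃(𝒪_w)`, `ᵗσ̄P₁·Φ₃·P₁ = ι-shape(diag d, η)` ON THE NOSE (the printed `!![…]` of (z1-e′)), `|dᵢ| = 1`, `σdᵢ = dᵢ`,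
`diag d` residually anisotropic (both clauses), `ση = η`, `|η| = 1`, `γ₁ ≡ 1 (mod ϖ²)`, `γ₁ ∈ U(σ_w, diag d)`, and `η` NOT a norm.

## References
* [Rogawski1990] J. D. Rogawski, *Automorphic Representations of Unitary Groups in Three Variables*, Ann. of Math. Stud. 123 (1990), §3.5 Prop. 3.5.2 (c) p. 29, §3.6 p. 31,
  §4.3 (4.3.2) p. 43, §4.9 Prop. 4.9.1 p. 55, §14.2 p. 233.
* [Jacobowitz1962] R. Jacobowitz, *Hermitian forms over local fields*, Amer. J. Math. 84 (1962), §8.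
* [LabesseLanglands1979] J.-P. Labesse, R. P. Langlands, *L-indistinguishability for SL(2)*, Canad. J. Math. 31 (1979), §2 pp. 8–10.
* [LanglandsShelstad1987] R. P. Langlands, D. Shelstad, *On the definition of transfer factors*, Math. Ann. 278 (1987), §1.
-/

set_option autoImplicit false

noncomputable section

open NumberField IsDedekindDomain Matrix Polynomial
open Literature.NumberTheory.Automorphic Literature.NumberTheory.Automorphic.UnitaryGroup Literature.NumberTheory.Automorphic.UnitaryLatticeTree
open Literature.NumberTheory.GaloisRepresentations Literature.NumberTheory.QuadraticForms
open scoped MatrixGroups ValuativeRel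

namespace Literature.NumberTheory.Rogawski1990

section CM

variable (L : Type) [Field L] [NumberField L] [IsCMField L] (H' : Matrix (Fin 3) (Fin 3) L) {v : HeightOneSpectrum (𝓞 ↥(maximalRealSubfield L))}
  (w : PlacesOver L v) (hw : IsCMField.complexConj L • w.1 = w.1)

include hw in
/-- **The κ-sign from an eigenvector of NON-NORM frame length** (the last step of ★ `exists_vDeep_oppositeLiteral_ram`, isolated): if `t₁` matches `γ_H` (`χ_{g_w}` rootless) and
`(t₁)_w` has a `u_w`-eigenvector `q₁` of `H′_w`-length `(−det H′_w)·η` with `η` a σ-fixed unit which is NOT a norm, then `κ_v(γ_H, t₁) = −(y_λ, θ)_v` for `ι_w y_λ = −det H′_w`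
(★ `finKappaAt_eq_ite_of_onePlace_eigenvector`, index two ★ `exists_norm_mul_nonNorm_iff`, ★ `hilbertSymbol_eq_one_iff_exists_norm_toPlace`).
[cite: Rogawski1990, §4.9 Prop. 4.9.1 p. 55; §4.3 (4.3.2) p. 43] [cite: LanglandsShelstad1987, §1] -/
theorem finKappaAt_eq_neg_hilbertSymbol_of_nonNorm_length (hH' : (H'.map (cmConjRingHom L)).transpose = H')
    (he : v.asIdeal.ramificationIdx' w.1.asIdeal ≠ 1) (hH'w : IsUnit (placeForm H' w.1)) (h2v : Valued.v (2 : w.1.adicCompletion L) = 1)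
    (yl : v.adicCompletion ↥(maximalRealSubfield L)) (hyl : toPlace v w yl = -(placeForm H' w.1).det)
    (γH : (cmDatum L 2 (Matrix.of fun i j : Fin 2 => if i.val + j.val + 1 = 2 then (1 : L) else 0)).Local v ×
      (cmDatum L 1 (Matrix.of fun i j : Fin 1 => if i.val + j.val + 1 = 1 then (1 : L) else 0)).Local v)
    (hirr : ¬ ∃ x : w.1.adicCompletion L, (((γH.1.val : GL (Fin 2) (UnitaryGroup.LocalRing L v)).val.map
        (Pi.evalRingHom (fun w' : PlacesOver L v => w'.1.adicCompletion L) w)).charpoly).IsRoot x)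
    {t₁ : (cmDatum L 3 H').Local v} (ht₁ : IsLocalNormPair L H' v γH t₁)
    {q₁ : Fin 3 → w.1.adicCompletion L}
    (hq₁ : (((localNonsplitEquiv (IsCMField.complexConj L) H' (IsCMField.complexConj_ne_one L) w hw t₁).val :
        GL (Fin 3) (w.1.adicCompletion L)) : Matrix (Fin 3) (Fin 3) (w.1.adicCompletion L)) *ᵥ q₁ = finGammaTwo L v γH w • q₁)
    (hq₁0 : q₁ ≠ 0) {η : w.1.adicCompletion L}
    (hlen₁ : (∑ i : Fin 3, ∑ k : Fin 3, galAdicCompletionMap (L := L) (IsCMField.complexConj L) hw (q₁ i) * placeForm H' w.1 i k * q₁ k) = (-(placeForm H' w.1).det) * η)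
    (hση : galAdicCompletionMap (L := L) (IsCMField.complexConj L) hw η = η) (hvη : Valued.v η = 1)
    (hηN : ¬ ∃ t : w.1.adicCompletion L, t * galAdicCompletionMap (L := L) (IsCMField.complexConj L) hw t = η) :
    finKappaAt L v H' γH t₁ = -hilbertSymbol (v.adicCompletion ↥(maximalRealSubfield L)) yl
        (algebraMap ↥(maximalRealSubfield L) _ ((cmQuadraticGenerator L : 𝓞 ↥(maximalRealSubfield L)) : ↥(maximalRealSubfield L))) := by
  haveI : Algebra.IsQuadraticExtension ↥(maximalRealSubfield L) L := IsCMField.isQuadraticExtension L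
  have hχ : IsUnit ((finCharpolyTwo L v γH).eval (finGammaTwo L v γH)) := isUnit_eval_finCharpolyTwo_of_not_exists_isRoot L w hw γH hirr
  have hdet0 : -(placeForm H' w.1).det ≠ 0 := (((Matrix.isUnit_iff_isUnit_det _).1 hH'w).neg).ne_zero
  have hη0 : η ≠ 0 := fun h0 => by rw [h0, map_zero] at hvη; exact zero_ne_one hvη
  have hlen0 : (∑ i : Fin 3, ∑ k : Fin 3, (galAdicCompletionMap (L := L) (IsCMField.complexConj L) hw) (q₁ i) * placeForm H' w.1 i k * q₁ k) ≠ 0 := by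
    rw [hlen₁]; exact mul_ne_zero hdet0 hη0
  rw [finKappaAt_eq_ite_of_onePlace_eigenvector L H' w hw γH hχ ht₁ hq₁ hq₁0 hlen0, hlen₁]
  -- index two: `(−det H′_w)·η ∈ N ⟺ −det H′_w ∉ N`, and `[−det H′_w ∈ N] = (y_λ, θ)_v`
  have hσdet : (galAdicCompletionMap (L := L) (IsCMField.complexConj L) hw) (-(placeForm H' w.1).det) = -(placeForm H' w.1).det := by
    have hh := placeForm_hermitian_of_smul_eq (IsCMField.complexConj L) w H' hH' hw
    have hdet := congrArg Matrix.det hh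
    rw [Matrix.det_transpose, ← RingHom.mapMatrix_apply, ← RingHom.map_det] at hdet
    rw [map_neg, hdet]
  have hdich := norm_dichotomy_of_not_norm L w hw he h2v hση hηN
  have hflip := exists_norm_mul_nonNorm_iff L w hw hηN hdich hdet0 hσdet
  have hy0 : yl ≠ 0 := fun h0 => hdet0 (by rw [← hyl, h0, map_zero])
  rcases hilbertSymbol_eq_one_or_eq_neg_one yl
      (algebraMap ↥(maximalRealSubfield L) _ ((cmQuadraticGenerator L : 𝓞 ↥(maximalRealSubfield L)) : ↥(maximalRealSubfield L))) with h1 | h1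
  · have hN : ∃ z : w.1.adicCompletion L, (galAdicCompletionMap (L := L) (IsCMField.complexConj L) hw) z * z = -(placeForm H' w.1).det := by
      rw [← hyl]; exact (hilbertSymbol_eq_one_iff_exists_norm_toPlace L v w hw hy0).1 h1
    rw [if_neg (fun h => hflip.1 h hN), h1]
  · have hN : ¬ ∃ z : w.1.adicCompletion L, (galAdicCompletionMap (L := L) (IsCMField.complexConj L) hw) z * z = -(placeForm H' w.1).det := fun hex => by
      have h := (hilbertSymbol_eq_one_iff_exists_norm_toPlace L v w hw hy0).2 (by rw [hyl]; exact hex)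
      rw [h] at h1
      exact absurd h1 (by norm_num)
    rw [if_pos (hflip.2 hN), h1, neg_neg]

set_option maxHeartbeats 400000 in
include hw in
/-- **THE OPPOSITE-SIGN v-DEEP LITERAL WITH ITS DIAGONAL BLOCK FRAME, IN THE e-CURRENCY** ((z4-i)).  Binders: those of ★ `exists_vDeep_oppositeLiteral_ram` (tame-ramified non-split `w ∣ v`,
`2 ∈ 𝒪_w^×`, anti-fixed uniformiser `ϖ`, integral antidiagonal frame `A ∈ GL₃(𝒪_w)` with `H′_w = (−det H′_w) • ᵗσ̄A·Φ₃·A`, `ι_w y_λ = −det H′_w`; `γ_H = (g, u)` in the 2-deep tube with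
rootless `χ_{g_w}`) PLUS a frame `e : G′_v ≃ₜ* U(σ_w, Φ₃)(L_w)` with `e(x) = A·x_w·A⁻¹` (the `(e) (heA)` of ★ p847724 VERBATIM).  Conclusion: `∃ t₁ P₁ d η γ₁` — `t₁` MATCHES `γ_H`, is
v-DEEP (the socket clause VERBATIM), `κ_v(γ_H, t₁) = −(y_λ, θ)_v`; and `e t₁ = P₁·endoGL(γ₁, u_w)·P₁⁻¹` with `P₁ ∈ GL₃(𝒪_w)`, `ᵗσ̄P₁·Φ₃,w·P₁ = ι-shape(diag d, η)` (the printed `!![…]`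
of ★ `UnitaryLatticeTreeAnisotropicAxisCount`), `|dᵢ| = 1`, `σdᵢ = dᵢ`, `diag d` RESIDUALLY ANISOTROPIC (both clauses), `ση = η`, `|η| = 1`, `γ₁ ≡ 1 (mod ϖ²)`, `γ₁ ∈ U(σ_w, diag d)`,
`η ∉ N(L_w^×)`.  (`e t₁ = Y`, the literal of ★ `exists_anisotropicLiteral_frame_ram`; `P₁, d, η = η, γ₁` its frame data.)
[cite: Rogawski1990, §4.9 Prop. 4.9.1 p. 55; §3.5 Prop. 3.5.2 (c) p. 29; §3.6 p. 31] [cite: Jacobowitz1962, §8] [cite: LabesseLanglands1979, §2 pp. 8–10] [cite: LanglandsShelstad1987, §1] -/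
theorem exists_vDeep_oppositeLiteral_frame_ram (hH' : (H'.map (cmConjRingHom L)).transpose = H')
    (he : v.asIdeal.ramificationIdx' w.1.asIdeal ≠ 1) (hH'w : IsUnit (placeForm H' w.1)) (h2 : IsUnit (2 : 𝒪[w.1.adicCompletion L]))
    (ϖ : w.1.adicCompletion L) (hϖ : Valued.v ϖ = WithZero.exp (-1 : ℤ)) (hσϖ : galAdicCompletionMap (L := L) (IsCMField.complexConj L) hw ϖ = -ϖ)
    (A : GL (Fin 3) (w.1.adicCompletion L)) (hA : A ∈ glInt 3 (w.1.adicCompletion L))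
    (hframe : placeForm H' w.1 = (-(placeForm H' w.1).det) •
      formCongr (galAdicCompletionMap (L := L) (IsCMField.complexConj L) hw) A ((StdForm.antidiagonal 3).over (w.1.adicCompletion L)))
    (yl : v.adicCompletion ↥(maximalRealSubfield L)) (hyl : toPlace v w yl = -(placeForm H' w.1).det)
    (e : ↥(UnitaryGroup.«local» L (IsCMField.complexConj L) 3 H' v) ≃ₜ*
      ↥(unitaryGroupOfForm (galAdicCompletionMap (L := L) (IsCMField.complexConj L) hw) (placeForm (Matrix.of fun i j : Fin 3 => if i.val + j.val + 1 = 3 then (1 : L) else 0) w.1)))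
    (heA : ∀ g : ((cmDatum L 3 H').Local v), (((e g) : ↥(unitaryGroupOfForm (galAdicCompletionMap (L := L) (IsCMField.complexConj L) hw)
        (placeForm (Matrix.of fun i j : Fin 3 => if i.val + j.val + 1 = 3 then (1 : L) else 0) w.1))) : GL (Fin 3) (w.1.adicCompletion L)) =
      A * ((localNonsplitEquiv (IsCMField.complexConj L) H' (IsCMField.complexConj_ne_one L) w hw g).val : GL (Fin 3) (w.1.adicCompletion L)) * A⁻¹)
    (γH : (cmDatum L 2 (Matrix.of fun i j : Fin 2 => if i.val + j.val + 1 = 2 then (1 : L) else 0)).Local v ×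
      (cmDatum L 1 (Matrix.of fun i j : Fin 1 => if i.val + j.val + 1 = 1 then (1 : L) else 0)).Local v)
    (hg : ∀ i j : Fin 2, Valued.v ((((γH.1.val : GL (Fin 2) (UnitaryGroup.LocalRing L v)).val.map (Pi.evalRingHom (fun w' : PlacesOver L v => w'.1.adicCompletion L) w)) - 1) i j) ≤ Valued.v (ϖ ^ 2))
    (hu2 : Valued.v (finGammaTwo L v γH w - 1) ≤ Valued.v (ϖ ^ 2))
    (hirr : ¬ ∃ x : w.1.adicCompletion L, (((γH.1.val : GL (Fin 2) (UnitaryGroup.LocalRing L v)).val.map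
        (Pi.evalRingHom (fun w' : PlacesOver L v => w'.1.adicCompletion L) w)).charpoly).IsRoot x) :
    ∃ (t₁ : (cmDatum L 3 H').Local v) (P₁ : GL (Fin 3) (w.1.adicCompletion L)) (d : Fin 2 → w.1.adicCompletion L) (η : w.1.adicCompletion L)
      (γ₁ : GL (Fin 2) (w.1.adicCompletion L)),
      IsLocalNormPair L H' v γH t₁ ∧
      (∀ a b, Valued.v (((toPlace v w (HeckeCharacter.uniformizer ↥(maximalRealSubfield L) v : v.adicCompletion ↥(maximalRealSubfield L))) ^ 1)⁻¹ * ((((t₁).val : GL (Fin 3) (UnitaryGroup.LocalRing L v)).val.map (Pi.evalRingHom (fun w' : PlacesOver L v => w'.1.adicCompletion L) w)) a b - (1 : Matrix (Fin 3) (Fin 3) (w.1.adicCompletion L)) a b)) ≤ 1) ∧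
      finKappaAt L v H' γH t₁ = -hilbertSymbol (v.adicCompletion ↥(maximalRealSubfield L)) yl
        (algebraMap ↥(maximalRealSubfield L) _ ((cmQuadraticGenerator L : 𝓞 ↥(maximalRealSubfield L)) : ↥(maximalRealSubfield L))) ∧
      (((e t₁) : ↥(unitaryGroupOfForm (galAdicCompletionMap (L := L) (IsCMField.complexConj L) hw)
          (placeForm (Matrix.of fun i j : Fin 3 => if i.val + j.val + 1 = 3 then (1 : L) else 0) w.1))) : GL (Fin 3) (w.1.adicCompletion L)) =
        P₁ * endoGL (γ₁, ((localNonsplitEquiv (IsCMField.complexConj L) (Matrix.of fun i j : Fin 1 => if i.val + j.val + 1 = 1 then (1 : L) else 0)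
          (IsCMField.complexConj_ne_one L) w hw γH.2).val : GL (Fin 1) (w.1.adicCompletion L))) * P₁⁻¹ ∧
      P₁ ∈ glInt 3 (w.1.adicCompletion L) ∧
      formCongr (galAdicCompletionMap (L := L) (IsCMField.complexConj L) hw) P₁ (placeForm (Matrix.of fun i j : Fin 3 => if i.val + j.val + 1 = 3 then (1 : L) else 0) w.1) =
        !![(Matrix.diagonal d) 0 0, 0, (Matrix.diagonal d) 0 1; 0, η, 0; (Matrix.diagonal d) 1 0, 0, (Matrix.diagonal d) 1 1] ∧
      (∀ i, Valued.v (d i) = 1) ∧ (∀ i, galAdicCompletionMap (L := L) (IsCMField.complexConj L) hw (d i) = d i) ∧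
      (∀ c : w.1.adicCompletion L, Valued.v c ≤ 1 → Valued.v (d 0 + d 1 * (galAdicCompletionMap (L := L) (IsCMField.complexConj L) hw c * c)) = 1) ∧
      (∀ c : w.1.adicCompletion L, Valued.v c ≤ 1 → Valued.v (d 0 * (galAdicCompletionMap (L := L) (IsCMField.complexConj L) hw c * c) + d 1) = 1) ∧
      galAdicCompletionMap (L := L) (IsCMField.complexConj L) hw η = η ∧ Valued.v η = 1 ∧
      (∀ i j, Valued.v (((γ₁ : Matrix (Fin 2) (Fin 2) (w.1.adicCompletion L)) - 1) i j) ≤ Valued.v (ϖ ^ 2)) ∧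
      γ₁ ∈ unitaryGroupOfForm (galAdicCompletionMap (L := L) (IsCMField.complexConj L) hw) (Matrix.diagonal d) ∧
      ¬ ∃ t : w.1.adicCompletion L, t * galAdicCompletionMap (L := L) (IsCMField.complexConj L) hw t = η := by
  haveI : Algebra.IsQuadraticExtension ↥(maximalRealSubfield L) L := IsCMField.isQuadraticExtension L
  have h2v : Valued.v (2 : w.1.adicCompletion L) = 1 :=
    (v_eq_one_iff_valuation_eq_one _).2 ((Valuation.integer.integers (ValuativeRel.valuation (w.1.adicCompletion L))).isUnit_iff_valuation_eq_one.1 h2)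
  -- the block `g_w` and the scalar `u_w` in the one-place models
  set g : GL (Fin 2) (w.1.adicCompletion L) := (localNonsplitEquiv (IsCMField.complexConj L)
      (Matrix.of fun i j : Fin 2 => if i.val + j.val + 1 = 2 then (1 : L) else 0) (IsCMField.complexConj_ne_one L) w hw γH.1).val with hgdef
  set uu : GL (Fin 1) (w.1.adicCompletion L) := (localNonsplitEquiv (IsCMField.complexConj L)
      (Matrix.of fun i j : Fin 1 => if i.val + j.val + 1 = 1 then (1 : L) else 0) (IsCMField.complexConj_ne_one L) w hw γH.2).val with huudef
  have hg' : (g : Matrix (Fin 2) (Fin 2) (w.1.adicCompletion L)) =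
      ((γH.1.val : GL (Fin 2) (UnitaryGroup.LocalRing L v)).val.map (Pi.evalRingHom (fun w' : PlacesOver L v => w'.1.adicCompletion L) w)) := rfl
  have hu' : (uu : Matrix (Fin 1) (Fin 1) (w.1.adicCompletion L)) 0 0 = finGammaTwo L v γH w := rfl
  have hgU : g ∈ unitaryGroupOfForm (galAdicCompletionMap (L := L) (IsCMField.complexConj L) hw) !![(0 : w.1.adicCompletion L), 1; 1, 0] := by
    have h : ((g : Matrix (Fin 2) (Fin 2) (w.1.adicCompletion L)).map (galAdicCompletionMap (L := L) (IsCMField.complexConj L) hw))ᵀ *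
        placeForm (Matrix.of fun i j : Fin 2 => if i.val + j.val + 1 = 2 then (1 : L) else 0) w.1 * (g : Matrix (Fin 2) (Fin 2) (w.1.adicCompletion L)) =
        placeForm (Matrix.of fun i j : Fin 2 => if i.val + j.val + 1 = 2 then (1 : L) else 0) w.1 :=
      mem_unitaryGroupOfForm_iff.1
        (localNonsplitEquiv (IsCMField.complexConj L) (Matrix.of fun i j : Fin 2 => if i.val + j.val + 1 = 2 then (1 : L) else 0) (IsCMField.complexConj_ne_one L) w hw γH.1).2
    rw [placeForm_antidiagOne, stdForm_antidiagonal_two_over_eq] at h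
    exact mem_unitaryGroupOfForm_iff.2 h
  have hA' : ∀ x : w.1.adicCompletion L, (g : Matrix (Fin 2) (Fin 2) (w.1.adicCompletion L)).charpoly.eval x ≠ 0 :=
    fun x hx => hirr ⟨x, by rw [← hg']; exact hx⟩
  have hg2 : ∀ i j, Valued.v (((g : Matrix (Fin 2) (Fin 2) (w.1.adicCompletion L)) - 1) i j) ≤ Valued.v (ϖ ^ 2) := by rw [hg']; exact hg
  have hu1 : (galAdicCompletionMap (L := L) (IsCMField.complexConj L) hw) ((uu : Matrix (Fin 1) (Fin 1) (w.1.adicCompletion L)) 0 0) * (uu : Matrix (Fin 1) (Fin 1) (w.1.adicCompletion L)) 0 0 = 1 := by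
    have h : ((uu : Matrix (Fin 1) (Fin 1) (w.1.adicCompletion L)).map (galAdicCompletionMap (L := L) (IsCMField.complexConj L) hw))ᵀ *
        placeForm (Matrix.of fun i j : Fin 1 => if i.val + j.val + 1 = 1 then (1 : L) else 0) w.1 * (uu : Matrix (Fin 1) (Fin 1) (w.1.adicCompletion L)) =
        placeForm (Matrix.of fun i j : Fin 1 => if i.val + j.val + 1 = 1 then (1 : L) else 0) w.1 :=
      mem_unitaryGroupOfForm_iff.1
        (localNonsplitEquiv (IsCMField.complexConj L) (Matrix.of fun i j : Fin 1 => if i.val + j.val + 1 = 1 then (1 : L) else 0) (IsCMField.complexConj_ne_one L) w hw γH.2).2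
    rw [placeForm_antidiagOne, stdForm_antidiagonal_one_over_eq] at h
    have hmat : (uu : Matrix (Fin 1) (Fin 1) (w.1.adicCompletion L)) = !![(uu : Matrix (Fin 1) (Fin 1) (w.1.adicCompletion L)) 0 0] := by
      ext i j; fin_cases i; fin_cases j; rfl
    rw [hmat] at h
    exact mul_self_map_eq_one_of_oneByOne_unitary (galAdicCompletionMap (L := L) (IsCMField.complexConj L) hw) h
  have hu2' : Valued.v ((uu : Matrix (Fin 1) (Fin 1) (w.1.adicCompletion L)) 0 0 - 1) ≤ Valued.v (ϖ ^ 2) := by rw [hu']; exact hu2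
  -- the anisotropic literal `Y ∈ U(σ_w, J₀)` with its diagonal block frame
  obtain ⟨Y, q, η, P, d, G₁, hYU, hY2, hconj, hYq, hq0, hlen, hση, hvη, hηN, hPint, hPform, hd, hσd, hanis₀, hanis₁, hG₁2, hG₁U, hYdef⟩ :=
    exists_anisotropicLiteral_frame_ram L w hw he h2v hϖ hσϖ g hgU hA' hg2 uu hu1 hu2'
  -- the pull-back `t₁ = e⁻¹(Y)` along the GIVEN frame
  have hYU' : Y ∈ unitaryGroupOfForm (galAdicCompletionMap (L := L) (IsCMField.complexConj L) hw) (placeForm (Matrix.of fun i j : Fin 3 => if i.val + j.val + 1 = 3 then (1 : L) else 0) w.1) := by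
    rw [placeForm_antidiagOne]; exact hYU
  obtain ⟨t₁, ht₁def⟩ : ∃ t₁ : (cmDatum L 3 H').Local v, t₁ = e.symm ⟨Y, hYU'⟩ := ⟨_, rfl⟩
  have het : ((e t₁).val : GL (Fin 3) (w.1.adicCompletion L)) = Y := by
    rw [ht₁def, ContinuousMulEquiv.apply_symm_apply]
  have hmat : ((localNonsplitEquiv (IsCMField.complexConj L) H' (IsCMField.complexConj_ne_one L) w hw t₁ :
      unitaryGroupOfForm (galAdicCompletionMap (L := L) (IsCMField.complexConj L) hw) (placeForm H' w.1)) : GL (Fin 3) (w.1.adicCompletion L)) = A⁻¹ * Y * A := by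
    have h := heA t₁
    rw [het] at h
    rw [h, mul_assoc A, inv_mul_cancel_left, inv_mul_cancel_right]
  -- matched (★ `isLocalNormPair_iff_isConj_endoGL_conj`), v-deep
  have ht₁ : IsLocalNormPair L H' v γH t₁ :=
    (isLocalNormPair_iff_isConj_endoGL_conj L H' w hw A γH t₁).2 (by rw [← heA t₁, het]; exact hconj)
  have hY2' : ∀ i j : Fin 3, Valued.v ((Y : Matrix (Fin 3) (Fin 3) (w.1.adicCompletion L)) i j - (1 : Matrix (Fin 3) (Fin 3) (w.1.adicCompletion L)) i j) ≤
      Valued.v (ϖ ^ 2) := fun i j => by rw [← Matrix.sub_apply]; exact hY2 i j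
  have hd₁ := vDeep_of_coe_eq_conj_of_entrywise_le L H' w hw he ϖ hϖ A hA Y hY2' hmat
  -- the κ-sign: eigenvector `A⁻¹ q` of length `(−det H′_w)·η`
  have hκ : finKappaAt L v H' γH t₁ = -hilbertSymbol (v.adicCompletion ↥(maximalRealSubfield L)) yl
      (algebraMap ↥(maximalRealSubfield L) _ ((cmQuadraticGenerator L : 𝓞 ↥(maximalRealSubfield L)) : ↥(maximalRealSubfield L))) := by
    obtain ⟨q₁, hq₁def⟩ : ∃ q₁ : Fin 3 → w.1.adicCompletion L,
        q₁ = ((A⁻¹ : GL (Fin 3) (w.1.adicCompletion L)) : Matrix (Fin 3) (Fin 3) (w.1.adicCompletion L)) *ᵥ q := ⟨_, rfl⟩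
    have hAAi : (A : Matrix (Fin 3) (Fin 3) (w.1.adicCompletion L)) * ((A⁻¹ : GL (Fin 3) (w.1.adicCompletion L)) : Matrix (Fin 3) (Fin 3) (w.1.adicCompletion L)) = 1 := by
      rw [← Units.val_mul, mul_inv_cancel, Units.val_one]
    have hq₁ : (((localNonsplitEquiv (IsCMField.complexConj L) H' (IsCMField.complexConj_ne_one L) w hw t₁ : unitaryGroupOfForm (galAdicCompletionMap (L := L) (IsCMField.complexConj L) hw) (placeForm H' w.1)) :
        GL (Fin 3) (w.1.adicCompletion L)) : Matrix (Fin 3) (Fin 3) (w.1.adicCompletion L)) *ᵥ q₁ = finGammaTwo L v γH w • q₁ := by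
      rw [hmat, hq₁def, Units.val_mul, Units.val_mul, Matrix.mulVec_mulVec, Matrix.mul_assoc, hAAi, Matrix.mul_one, ← Matrix.mulVec_mulVec, hYq, hu',
        Matrix.mulVec_smul]
    have hq₁0 : q₁ ≠ 0 := by
      intro h0
      apply hq0
      have h : (A : Matrix (Fin 3) (Fin 3) (w.1.adicCompletion L)) *ᵥ q₁ = q := by
        rw [hq₁def, Matrix.mulVec_mulVec, hAAi, Matrix.one_mulVec]
      rw [← h, h0, Matrix.mulVec_zero]
    have hlen₁ : (∑ i : Fin 3, ∑ k : Fin 3, (galAdicCompletionMap (L := L) (IsCMField.complexConj L) hw) (q₁ i) * placeForm H' w.1 i k * q₁ k) = (-(placeForm H' w.1).det) * η := by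
      rw [hq₁def, length_inv_mulVec_of_frame L H' w hw A hframe q, hlen]
    exact finKappaAt_eq_neg_hilbertSymbol_of_nonNorm_length L H' w hw hH' he hH'w h2v yl hyl γH hirr ht₁ hq₁ hq₁0 hlen₁ hση hvη hηN
  -- the frame data
  have hframe₁ : ((e t₁).val : GL (Fin 3) (w.1.adicCompletion L)) = P * endoGL (G₁, uu) * P⁻¹ := by rw [het]; exact hYdef
  have hPform' : formCongr (galAdicCompletionMap (L := L) (IsCMField.complexConj L) hw) P (placeForm (Matrix.of fun i j : Fin 3 => if i.val + j.val + 1 = 3 then (1 : L) else 0) w.1) =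
      !![(Matrix.diagonal d) 0 0, 0, (Matrix.diagonal d) 0 1; 0, η, 0; (Matrix.diagonal d) 1 0, 0, (Matrix.diagonal d) 1 1] := by
    rw [placeForm_antidiagOne]; exact hPform
  exact ⟨t₁, P, d, η, G₁, ht₁, hd₁, hκ, hframe₁, hPint, hPform', hd, hσd, hanis₀, hanis₁, hση, hvη, hG₁2, hG₁U, hηN⟩

include hw in
/-- **THE FRAME LITERAL `t₀` IN THE e-CURRENCY** (companion of `exists_vDeep_oppositeLiteral_frame_ram`, sign `+(y_λ, θ)_v`; ★ F0P3a-p03 `exists_isLocalNormPair_coe_eq_of_frame` ∕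
`vDeep_of_coe_eq_of_frame` ∕ `finKappaAt_eq_hilbertSymbol_of_coe_eq_of_frame` read through a GIVEN frame `(e, heA)`): `∃ t₀` MATCHED with `γ_H`, v-DEEP (socket clause VERBATIM),
`κ_v(γ_H, t₀) = (y_λ, θ)_v`, and `e t₀ = endoGL(g_w, u_w)` ON THE NOSE — block frame `P₀ = 1`, block form the hyperbolic plane `Φ₂` inside `Φ₃ = ι-shape(Φ₂, 1)`.
[cite: Rogawski1990, §4.9 Prop. 4.9.1 p. 55; §4.3 (4.3.2) p. 43; §14.2 p. 233] [cite: Jacobowitz1962, §7 Thm. 7.1] [cite: LanglandsShelstad1987, §1] -/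
theorem exists_vDeep_frameLiteral_frame_ram
    (he : v.asIdeal.ramificationIdx' w.1.asIdeal ≠ 1) (hH'w : IsUnit (placeForm H' w.1))
    (ϖ : w.1.adicCompletion L) (hϖ : Valued.v ϖ = WithZero.exp (-1 : ℤ))
    (A : GL (Fin 3) (w.1.adicCompletion L)) (hA : A ∈ glInt 3 (w.1.adicCompletion L))
    (hframe : placeForm H' w.1 = (-(placeForm H' w.1).det) •
      formCongr (galAdicCompletionMap (L := L) (IsCMField.complexConj L) hw) A ((StdForm.antidiagonal 3).over (w.1.adicCompletion L)))
    (yl : v.adicCompletion ↥(maximalRealSubfield L)) (hyl : toPlace v w yl = -(placeForm H' w.1).det)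
    (e : ↥(UnitaryGroup.«local» L (IsCMField.complexConj L) 3 H' v) ≃ₜ*
      ↥(unitaryGroupOfForm (galAdicCompletionMap (L := L) (IsCMField.complexConj L) hw) (placeForm (Matrix.of fun i j : Fin 3 => if i.val + j.val + 1 = 3 then (1 : L) else 0) w.1)))
    (heA : ∀ g : ((cmDatum L 3 H').Local v), (((e g) : ↥(unitaryGroupOfForm (galAdicCompletionMap (L := L) (IsCMField.complexConj L) hw)
        (placeForm (Matrix.of fun i j : Fin 3 => if i.val + j.val + 1 = 3 then (1 : L) else 0) w.1))) : GL (Fin 3) (w.1.adicCompletion L)) =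
      A * ((localNonsplitEquiv (IsCMField.complexConj L) H' (IsCMField.complexConj_ne_one L) w hw g).val : GL (Fin 3) (w.1.adicCompletion L)) * A⁻¹)
    (γH : (cmDatum L 2 (Matrix.of fun i j : Fin 2 => if i.val + j.val + 1 = 2 then (1 : L) else 0)).Local v ×
      (cmDatum L 1 (Matrix.of fun i j : Fin 1 => if i.val + j.val + 1 = 1 then (1 : L) else 0)).Local v)
    (hg : ∀ i j : Fin 2, Valued.v ((((γH.1.val : GL (Fin 2) (UnitaryGroup.LocalRing L v)).val.map (Pi.evalRingHom (fun w' : PlacesOver L v => w'.1.adicCompletion L) w)) - 1) i j) ≤ Valued.v (ϖ ^ 2))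
    (hu2 : Valued.v (finGammaTwo L v γH w - 1) ≤ Valued.v (ϖ ^ 2))
    (hirr : ¬ ∃ x : w.1.adicCompletion L, (((γH.1.val : GL (Fin 2) (UnitaryGroup.LocalRing L v)).val.map
        (Pi.evalRingHom (fun w' : PlacesOver L v => w'.1.adicCompletion L) w)).charpoly).IsRoot x) :
    ∃ t₀ : (cmDatum L 3 H').Local v,
      IsLocalNormPair L H' v γH t₀ ∧
      (∀ a b, Valued.v (((toPlace v w (HeckeCharacter.uniformizer ↥(maximalRealSubfield L) v : v.adicCompletion ↥(maximalRealSubfield L))) ^ 1)⁻¹ * ((((t₀).val : GL (Fin 3) (UnitaryGroup.LocalRing L v)).val.map (Pi.evalRingHom (fun w' : PlacesOver L v => w'.1.adicCompletion L) w)) a b - (1 : Matrix (Fin 3) (Fin 3) (w.1.adicCompletion L)) a b)) ≤ 1) ∧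
      finKappaAt L v H' γH t₀ = hilbertSymbol (v.adicCompletion ↥(maximalRealSubfield L)) yl
        (algebraMap ↥(maximalRealSubfield L) _ ((cmQuadraticGenerator L : 𝓞 ↥(maximalRealSubfield L)) : ↥(maximalRealSubfield L))) ∧
      (((e t₀) : ↥(unitaryGroupOfForm (galAdicCompletionMap (L := L) (IsCMField.complexConj L) hw)
          (placeForm (Matrix.of fun i j : Fin 3 => if i.val + j.val + 1 = 3 then (1 : L) else 0) w.1))) : GL (Fin 3) (w.1.adicCompletion L)) =
        endoGL
          (((localNonsplitEquiv (IsCMField.complexConj L)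
              (Matrix.of fun i j : Fin 2 => if i.val + j.val + 1 = 2 then (1 : L) else 0) (IsCMField.complexConj_ne_one L) w hw γH.1).val :
              GL (Fin 2) (w.1.adicCompletion L)),
            ((localNonsplitEquiv (IsCMField.complexConj L)
              (Matrix.of fun i j : Fin 1 => if i.val + j.val + 1 = 1 then (1 : L) else 0) (IsCMField.complexConj_ne_one L) w hw γH.2).val :
              GL (Fin 1) (w.1.adicCompletion L))) := by
  obtain ⟨t₀, ht₀, hmat⟩ := exists_isLocalNormPair_coe_eq_of_frame L H' w hw hH'w A hframe γH
  have hu : IsUnit ((finCharpolyTwo L v γH).eval (finGammaTwo L v γH)) := isUnit_eval_finCharpolyTwo_of_not_exists_isRoot L w hw γH hirr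
  refine ⟨t₀, ht₀, vDeep_of_coe_eq_of_frame L H' w hw he ϖ hϖ A hA γH hg hu2 hmat,
    finKappaAt_eq_hilbertSymbol_of_coe_eq_of_frame L H' w hw hH'w A hframe yl hyl γH hu ht₀ hmat, ?_⟩
  rw [heA t₀, hmat, mul_assoc A⁻¹, mul_inv_cancel_left, mul_inv_cancel_right]

/-- **Equal conjugacy classes of `ι`-patterns force equal block characteristic polynomials**: `ι(a, u) ∼ ι(b, u)` in `GL₃(K)` gives `χ_a·χ_u = χ_b·χ_u` (★ `coe_endoGL` is
`reindex endoPerm (a ⊕ u)`; `Matrix.charpoly_reindex`, `Matrix.charpoly_fromBlocks_zero₁₂`) and `χ_u` is monic, hence cancels. [cite: Rogawski1990, §4.8 Case (a) p. 53; §4.3 (4.3.2) p. 43] -/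
theorem charpoly_eq_of_isConj_endoGL {K : Type*} [Field K] {a b : GL (Fin 2) K} {u : GL (Fin 1) K} (h : IsConj (endoGL (a, u)) (endoGL (b, u))) :
    (a : Matrix (Fin 2) (Fin 2) K).charpoly = (b : Matrix (Fin 2) (Fin 2) K).charpoly := by
  obtain ⟨c, hc⟩ := isConj_iff.1 h
  have hm : (c : Matrix (Fin 3) (Fin 3) K) * ((endoGL (a, u) : GL (Fin 3) K) : Matrix (Fin 3) (Fin 3) K) * (c : Matrix (Fin 3) (Fin 3) K)⁻¹ =
      ((endoGL (b, u) : GL (Fin 3) K) : Matrix (Fin 3) (Fin 3) K) := by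
    rw [← Matrix.coe_units_inv, ← Units.val_mul, ← Units.val_mul, hc]
  have hcp := Matrix.charpoly_units_conj c ((endoGL (a, u) : GL (Fin 3) K) : Matrix (Fin 3) (Fin 3) K)
  rw [hm, coe_endoGL, coe_endoGL, Matrix.charpoly_reindex, Matrix.charpoly_reindex, Matrix.charpoly_fromBlocks_zero₁₂, Matrix.charpoly_fromBlocks_zero₁₂] at hcp
  exact (mul_right_cancel₀ (Matrix.charpoly_monic _).ne_zero hcp).symm

include hw in
/-- **THE OPPOSITE LITERAL'S BLOCK HAS THE SPECTRUM OF `g_w`** (ED. 3, the spectral tie for F0P3a-p03 (g18)'s `hBlockLaw`): `exists_vDeep_oppositeLiteral_frame_ram` with ONE more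
clause, `χ_{γ₁} = χ_{g_w}` (the `g_w` spelling of the sockets) — matching ⟺ `ι(g_w, u_w) ∼ e t₁ = P₁·ι(γ₁, u_w)·P₁⁻¹` (★ `isLocalNormPair_iff_isConj_endoGL_conj`) and
`charpoly_eq_of_isConj_endoGL`.  So `γ₁` is rootless with the disc depth of `g_w`. [cite: Rogawski1990, §4.9 Prop. 4.9.1 p. 55; §4.3 (4.3.2) p. 43] [cite: LanglandsShelstad1987, §1] -/
theorem exists_vDeep_oppositeLiteral_frame_charpoly_ram (hH' : (H'.map (cmConjRingHom L)).transpose = H')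
    (he : v.asIdeal.ramificationIdx' w.1.asIdeal ≠ 1) (hH'w : IsUnit (placeForm H' w.1)) (h2 : IsUnit (2 : 𝒪[w.1.adicCompletion L]))
    (ϖ : w.1.adicCompletion L) (hϖ : Valued.v ϖ = WithZero.exp (-1 : ℤ)) (hσϖ : galAdicCompletionMap (L := L) (IsCMField.complexConj L) hw ϖ = -ϖ)
    (A : GL (Fin 3) (w.1.adicCompletion L)) (hA : A ∈ glInt 3 (w.1.adicCompletion L))
    (hframe : placeForm H' w.1 = (-(placeForm H' w.1).det) •
      formCongr (galAdicCompletionMap (L := L) (IsCMField.complexConj L) hw) A ((StdForm.antidiagonal 3).over (w.1.adicCompletion L)))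
    (yl : v.adicCompletion ↥(maximalRealSubfield L)) (hyl : toPlace v w yl = -(placeForm H' w.1).det)
    (e : ↥(UnitaryGroup.«local» L (IsCMField.complexConj L) 3 H' v) ≃ₜ*
      ↥(unitaryGroupOfForm (galAdicCompletionMap (L := L) (IsCMField.complexConj L) hw) (placeForm (Matrix.of fun i j : Fin 3 => if i.val + j.val + 1 = 3 then (1 : L) else 0) w.1)))
    (heA : ∀ g : ((cmDatum L 3 H').Local v), (((e g) : ↥(unitaryGroupOfForm (galAdicCompletionMap (L := L) (IsCMField.complexConj L) hw)
        (placeForm (Matrix.of fun i j : Fin 3 => if i.val + j.val + 1 = 3 then (1 : L) else 0) w.1))) : GL (Fin 3) (w.1.adicCompletion L)) =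
      A * ((localNonsplitEquiv (IsCMField.complexConj L) H' (IsCMField.complexConj_ne_one L) w hw g).val : GL (Fin 3) (w.1.adicCompletion L)) * A⁻¹)
    (γH : (cmDatum L 2 (Matrix.of fun i j : Fin 2 => if i.val + j.val + 1 = 2 then (1 : L) else 0)).Local v ×
      (cmDatum L 1 (Matrix.of fun i j : Fin 1 => if i.val + j.val + 1 = 1 then (1 : L) else 0)).Local v)
    (hg : ∀ i j : Fin 2, Valued.v ((((γH.1.val : GL (Fin 2) (UnitaryGroup.LocalRing L v)).val.map (Pi.evalRingHom (fun w' : PlacesOver L v => w'.1.adicCompletion L) w)) - 1) i j) ≤ Valued.v (ϖ ^ 2))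
    (hu2 : Valued.v (finGammaTwo L v γH w - 1) ≤ Valued.v (ϖ ^ 2))
    (hirr : ¬ ∃ x : w.1.adicCompletion L, (((γH.1.val : GL (Fin 2) (UnitaryGroup.LocalRing L v)).val.map
        (Pi.evalRingHom (fun w' : PlacesOver L v => w'.1.adicCompletion L) w)).charpoly).IsRoot x) :
    ∃ (t₁ : (cmDatum L 3 H').Local v) (P₁ : GL (Fin 3) (w.1.adicCompletion L)) (d : Fin 2 → w.1.adicCompletion L) (η : w.1.adicCompletion L)
      (γ₁ : GL (Fin 2) (w.1.adicCompletion L)),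
      IsLocalNormPair L H' v γH t₁ ∧
      (∀ a b, Valued.v (((toPlace v w (HeckeCharacter.uniformizer ↥(maximalRealSubfield L) v : v.adicCompletion ↥(maximalRealSubfield L))) ^ 1)⁻¹ * ((((t₁).val : GL (Fin 3) (UnitaryGroup.LocalRing L v)).val.map (Pi.evalRingHom (fun w' : PlacesOver L v => w'.1.adicCompletion L) w)) a b - (1 : Matrix (Fin 3) (Fin 3) (w.1.adicCompletion L)) a b)) ≤ 1) ∧
      finKappaAt L v H' γH t₁ = -hilbertSymbol (v.adicCompletion ↥(maximalRealSubfield L)) yl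
        (algebraMap ↥(maximalRealSubfield L) _ ((cmQuadraticGenerator L : 𝓞 ↥(maximalRealSubfield L)) : ↥(maximalRealSubfield L))) ∧
      (((e t₁) : ↥(unitaryGroupOfForm (galAdicCompletionMap (L := L) (IsCMField.complexConj L) hw)
          (placeForm (Matrix.of fun i j : Fin 3 => if i.val + j.val + 1 = 3 then (1 : L) else 0) w.1))) : GL (Fin 3) (w.1.adicCompletion L)) =
        P₁ * endoGL (γ₁, ((localNonsplitEquiv (IsCMField.complexConj L) (Matrix.of fun i j : Fin 1 => if i.val + j.val + 1 = 1 then (1 : L) else 0)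
          (IsCMField.complexConj_ne_one L) w hw γH.2).val : GL (Fin 1) (w.1.adicCompletion L))) * P₁⁻¹ ∧
      P₁ ∈ glInt 3 (w.1.adicCompletion L) ∧
      formCongr (galAdicCompletionMap (L := L) (IsCMField.complexConj L) hw) P₁ (placeForm (Matrix.of fun i j : Fin 3 => if i.val + j.val + 1 = 3 then (1 : L) else 0) w.1) =
        !![(Matrix.diagonal d) 0 0, 0, (Matrix.diagonal d) 0 1; 0, η, 0; (Matrix.diagonal d) 1 0, 0, (Matrix.diagonal d) 1 1] ∧
      (∀ i, Valued.v (d i) = 1) ∧ (∀ i, galAdicCompletionMap (L := L) (IsCMField.complexConj L) hw (d i) = d i) ∧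
      (∀ c : w.1.adicCompletion L, Valued.v c ≤ 1 → Valued.v (d 0 + d 1 * (galAdicCompletionMap (L := L) (IsCMField.complexConj L) hw c * c)) = 1) ∧
      (∀ c : w.1.adicCompletion L, Valued.v c ≤ 1 → Valued.v (d 0 * (galAdicCompletionMap (L := L) (IsCMField.complexConj L) hw c * c) + d 1) = 1) ∧
      galAdicCompletionMap (L := L) (IsCMField.complexConj L) hw η = η ∧ Valued.v η = 1 ∧
      (∀ i j, Valued.v (((γ₁ : Matrix (Fin 2) (Fin 2) (w.1.adicCompletion L)) - 1) i j) ≤ Valued.v (ϖ ^ 2)) ∧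
      γ₁ ∈ unitaryGroupOfForm (galAdicCompletionMap (L := L) (IsCMField.complexConj L) hw) (Matrix.diagonal d) ∧
      (¬ ∃ t : w.1.adicCompletion L, t * galAdicCompletionMap (L := L) (IsCMField.complexConj L) hw t = η) ∧
      (γ₁ : Matrix (Fin 2) (Fin 2) (w.1.adicCompletion L)).charpoly =
        (((γH.1.val : GL (Fin 2) (UnitaryGroup.LocalRing L v)).val.map (Pi.evalRingHom (fun w' : PlacesOver L v => w'.1.adicCompletion L) w))).charpoly := by
  obtain ⟨t₁, P₁, d, η, γ₁, ht₁, hd₁, hκ, het, hPint, hPform, hd, hσd, hanis₀, hanis₁, hση, hvη, hγ2, hγU, hηN⟩ :=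
    exists_vDeep_oppositeLiteral_frame_ram L H' w hw hH' he hH'w h2 ϖ hϖ hσϖ A hA hframe yl hyl e heA γH hg hu2 hirr
  refine ⟨t₁, P₁, d, η, γ₁, ht₁, hd₁, hκ, het, hPint, hPform, hd, hσd, hanis₀, hanis₁, hση, hvη, hγ2, hγU, hηN, ?_⟩
  -- matching ⟺ `ι(g_w, u_w) ∼ e t₁ = P₁·ι(γ₁, u_w)·P₁⁻¹`
  have hconj := (isLocalNormPair_iff_isConj_endoGL_conj L H' w hw A γH t₁).1 ht₁
  rw [← heA t₁, het] at hconj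
  have hconj' : IsConj
      (endoGL (((localNonsplitEquiv (IsCMField.complexConj L) (Matrix.of fun i j : Fin 2 => if i.val + j.val + 1 = 2 then (1 : L) else 0)
          (IsCMField.complexConj_ne_one L) w hw γH.1).val : GL (Fin 2) (w.1.adicCompletion L)),
        ((localNonsplitEquiv (IsCMField.complexConj L) (Matrix.of fun i j : Fin 1 => if i.val + j.val + 1 = 1 then (1 : L) else 0)
          (IsCMField.complexConj_ne_one L) w hw γH.2).val : GL (Fin 1) (w.1.adicCompletion L))))
      (endoGL (γ₁, ((localNonsplitEquiv (IsCMField.complexConj L) (Matrix.of fun i j : Fin 1 => if i.val + j.val + 1 = 1 then (1 : L) else 0)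
          (IsCMField.complexConj_ne_one L) w hw γH.2).val : GL (Fin 1) (w.1.adicCompletion L)))) :=
    hconj.trans (isConj_iff.2 ⟨P₁⁻¹, by rw [inv_inv, ← mul_assoc, ← mul_assoc, inv_mul_cancel, one_mul, inv_mul_cancel_right]⟩)
  exact (charpoly_eq_of_isConj_endoGL hconj').symm

end CM

end Literature.NumberTheory.Rogawski1990

end
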